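import Literature.AlgebraicGeometry.GroupSchemes.AffineGroupSchemeSpecPoints
import Literature.AlgebraicGeometry.GroupSchemes.GroupObjectOfPointwiseLaws
import Mathlib.RingTheory.HopfAlgebra.Convolution
import HarnessLib

/-!
# The affine group scheme of a commutative Hopf algebra (Görtz–Wedhorn II §(27.2), the converse direction)

Topic `Literature/AlgebraicGeometry/GroupSchemes`; namespace `Literature.AlgebraicGeometry.GroupSchemes.AffineGroupScheme`.  DEFINITIONS +
theorems (no named fact, no instance, no notation, no `sorry`).  Cell `hodgecm-mathlib` (D-0151), programme P6 «MOD», HEART organ GAP-1,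
clause (iii): the CONVERSE of ★ `AffineGroupSchemeHopfAlgebra` (p844646, which turns an affine group scheme `G → Spec R` into the commutative
Hopf `R`-algebra `Alg G = Γ(G, 𝒪_G)`).  Here a commutative Hopf `R`-algebra `H` — more generally a functorial group law
★ `CorepGroupLaw R H` on the points `Hom_{R-alg}(H, R′)` — is turned into a GROUP OBJECT structure on the `R`-scheme
`specOver R H = (Spec H → Spec R)` of Mathlib's cartesian monoidal category `Over (Spec R)` ([GortzWedhorn2023] §(27.2), Def. 27.6:
«affine group schemes over `R` "are" commutative Hopf `R`-algebras»; [SGA3] I 2.3.3: group functors = group objects).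

* §1 **Coordinates of `T`-points for EVERY `R`-scheme `T`** (not only affine test rings): `Alg.comap` (`Γ`-functoriality),
  `coord x : H →ₐ[R] Alg T` for `x : T ⟶ specOver R H`, its inverse `pt`, **`coordEquiv T : (T ⟶ specOver R H) ≃ (H →ₐ[R] Alg T)`**
  (Mathlib `ΓSpec.adjunction`: `ext_to_Spec`, `Scheme.toSpecΓ`), `coord_comp` (naturality in `T`).
* §2 **The group object of a functorial group law**: `mulOfLaw ∕ oneOfLaw ∕ invOfLaw L`, `coord_lift_comp_mulOfLaw` & co., and
  **`grpObjOfLaw L : GrpObj (specOver R H)`** (★ `exists_grpObj_of_pointwise`) with `grpObjOfLaw_mul ∕ _one ∕ _inv`; on `T`-points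
  `coord (a * b) = L.mul (coord a) (coord b)`, `coord 1 = L.one _`, `coord a⁻¹ = L.inv (coord a)`; `isCommMonObj_grpObjOfLaw` for a
  commutative law.
* §3 **The law of a commutative Hopf algebra**: `toConv_comp_antipodeAlgHom_mul` (the antipode inverts points valued in ANY commutative
  `R`-algebra — Mathlib's `AlgHom.convGroup` asks the target to be a bialgebra), `lawOfHopfAlgebra R H : CorepGroupLaw R H` (product =
  Mathlib's convolution on `WithConv (H →ₐ[R] R′)`), `lawOfHopfAlgebra_comul = comulAlgHom`, `_counit = counitAlgHom`,
  `_antipodeAlgHom = HopfAlgebra.antipodeAlgHom`.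
* §4 **`grpObjOfHopfAlgebra R H : GrpObj (specOver R H)`**, `coordMulEquiv T : (T ⟶ specOver R H) ≃* WithConv (H →ₐ[R] Alg T)`,
  `coord_one_eq ∕ coord_inv_eq`, and `isCommMonObj_grpObjOfHopfAlgebra` for cocommutative `H`.

HC_CM is proved only modulo the 7 printed citations until rung 0 closes; this file discharges none of them.
References: [GortzWedhorn2023] U. Görtz, T. Wedhorn, *Algebraic Geometry II* (2023), §(27.2), (27.2.1), Def. 27.6 (PDF p. 800 =
printed p. 606); [SGA3] M. Demazure, A. Grothendieck, *Schémas en groupes I*, Exp. I, 2.3.3.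
-/

set_option autoImplicit false
universe u
open CategoryTheory CategoryTheory.Limits AlgebraicGeometry MonoidalCategory CartesianMonoidalCategory TensorProduct WithConv

noncomputable section

namespace Literature.AlgebraicGeometry.GroupSchemes

namespace AffineGroupScheme

open scoped MonObj

open Literature.AlgebraicGeometry.Motives Literature.NumberTheory.DiophantineGeometry

variable {R : Type u} [CommRing R]

/-! ## §1 Coordinates of `T`-points of `Spec H → Spec R`, for every `R`-scheme `T` -/

section Comap

variable {T T' T'' : SchemeOver R}

/-- **`Γ` is a functor**: an `R`-morphism `g : T′ ⟶ T` induces the `R`-algebra map `Γ(T, 𝒪) → Γ(T′, 𝒪)` (pull-back of functions).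
[cite: GortzWedhorn2023, §(27.2) (p. 606)] -/
def Alg.comap (g : T' ⟶ T) : Alg T →ₐ[R] Alg T' where
  toRingHom := g.left.appTop.hom
  commutes' r := by
    change g.left.appTop.hom (((Scheme.ΓSpecIso (CommRingCat.of R)).inv ≫ T.hom.appTop).hom r) =
      ((Scheme.ΓSpecIso (CommRingCat.of R)).inv ≫ T'.hom.appTop).hom r
    rw [← Over.w g]
    rfl

/-- `Alg.comap g` is `Γ(g)` on elements. [cite: GortzWedhorn2023, §(27.2) (p. 606)] -/
theorem Alg.comap_apply (g : T' ⟶ T) (a : Alg T) : Alg.comap g a = g.left.appTop.hom a := rfl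

/-- `Γ(𝟙) = id`. [cite: GortzWedhorn2023, §(27.2) (p. 606)] -/
theorem Alg.comap_id : Alg.comap (𝟙 T) = AlgHom.id R (Alg T) := by
  ext a
  rfl

/-- `Γ(g′ ≫ g) = Γ(g′) ∘ Γ(g)`. [cite: GortzWedhorn2023, §(27.2) (p. 606)] -/
theorem Alg.comap_comp (g' : T'' ⟶ T') (g : T' ⟶ T) : Alg.comap (g' ≫ g) = (Alg.comap g').comp (Alg.comap g) := by
  ext a
  rfl

end Comap

section Coord

variable {H : Type u} [CommRing H] [Algebra R H] {T T' : SchemeOver R}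

/-- **The coordinates of a `T`-point** `x : T → Spec H` over `R`: the `R`-algebra map `H ≅ Γ(Spec H, 𝒪) → Γ(T, 𝒪)`
([GortzWedhorn2023] §(27.2): `Hom_R(T, Spec H) = Hom_{R-alg}(H, Γ(T, 𝒪_T))`). [cite: GortzWedhorn2023, §(27.2) (p. 606)] -/
def coord (x : T ⟶ specOver R H) : H →ₐ[R] Alg T :=
  (Alg.comap x).comp (algSpecOverEquiv H).symm.toAlgHom

/-- `coord x` on elements. [cite: GortzWedhorn2023, §(27.2) (p. 606)] -/
theorem coord_apply (x : T ⟶ specOver R H) (a : H) :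
    coord x a = x.left.appTop.hom ((Scheme.ΓSpecIso (CommRingCat.of H)).inv.hom a) := rfl

/-- **Naturality in `T`**: the coordinates of `g ≫ x` are those of `x` followed by `Γ(g)`. [cite: GortzWedhorn2023, §(27.2) (p. 606)] -/
theorem coord_comp (g : T' ⟶ T) (x : T ⟶ specOver R H) : coord (g ≫ x) = (Alg.comap g).comp (coord x) := by
  rw [coord, coord, ← AlgHom.comp_assoc, ← Alg.comap_comp]

/-- The ring map `H → Γ(T, 𝒪_T)` of an `R`-algebra map `φ : H → Alg T`, as a morphism of `CommRingCat` with target LITERALLY `Γ(T, ⊤)`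
(so that it composes with Mathlib's `Scheme.toSpecΓ ∕ ΓSpecIso` without unfolding `Alg`). [cite: GortzWedhorn2023, §(27.2) (p. 606)] -/
def homΓ (φ : H →ₐ[R] Alg T) : CommRingCat.of H ⟶ Γ(T.left, ⊤) := CommRingCat.ofHom φ.toRingHom

/-- `homΓ φ` on elements is `φ`. [cite: GortzWedhorn2023, §(27.2) (p. 606)] -/
theorem homΓ_apply (φ : H →ₐ[R] Alg T) (a : H) : (homΓ φ).hom a = φ a := rfl

/-- `homΓ` is injective. [cite: GortzWedhorn2023, §(27.2) (p. 606)] -/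
theorem homΓ_injective : Function.Injective (homΓ : (H →ₐ[R] Alg T) → (CommRingCat.of H ⟶ Γ(T.left, ⊤))) := by
  intro φ ψ h
  ext a
  rw [← homΓ_apply, h, homΓ_apply]

/-- **`homΓ (coord x) = (Γ(Spec H) ≅ H)⁻¹ ≫ Γ(x)`.** [cite: GortzWedhorn2023, §(27.2) (p. 606)] -/
theorem homΓ_coord (x : T ⟶ specOver R H) : homΓ (coord x) = (Scheme.ΓSpecIso (CommRingCat.of H)).inv ≫ x.left.appTop := rfl

/-- `R`-linearity of `φ` in `CommRingCat`: `(R → H) ≫ homΓ φ` is the structure map `R → Γ(T, 𝒪_T)`. [cite: GortzWedhorn2023, §(27.2) (p. 606)] -/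
theorem ofHom_algebraMap_comp_homΓ (φ : H →ₐ[R] Alg T) :
    CommRingCat.ofHom (algebraMap R H) ≫ homΓ φ = (Scheme.ΓSpecIso (CommRingCat.of R)).inv ≫ T.hom.appTop := by
  ext r
  exact φ.commutes r

/-- **The point with given coordinates**: `φ : H → Γ(T, 𝒪)` over `R` defines `T → Spec Γ(T, 𝒪) → Spec H` over `R`
(Mathlib `Scheme.toSpecΓ`). [cite: GortzWedhorn2023, §(27.2) (p. 606)] -/
def pt (φ : H →ₐ[R] Alg T) : T ⟶ specOver R H :=
  Over.homMk (T.left.toSpecΓ ≫ Spec.map (homΓ φ)) (by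
    change (T.left.toSpecΓ ≫ Spec.map (homΓ φ)) ≫ Spec.map (CommRingCat.ofHom (algebraMap R H)) = T.hom
    rw [Category.assoc, ← Spec.map_comp, ofHom_algebraMap_comp_homΓ, Spec.map_comp, ← Category.assoc,
      ← Scheme.toSpecΓ_naturality, Category.assoc, toSpecΓ_SpecMap_ΓSpecIso_inv, Category.comp_id])

/-- The underlying scheme morphism of `pt φ`. [cite: GortzWedhorn2023, §(27.2) (p. 606)] -/
theorem pt_left (φ : H →ₐ[R] Alg T) : (pt φ).left = T.left.toSpecΓ ≫ Spec.map (homΓ φ) := rfl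

/-- `Γ` of `pt φ`, read through `Γ(Spec H) ≅ H`, is `φ`. [cite: GortzWedhorn2023, §(27.2) (p. 606)] -/
theorem ΓSpecIso_inv_comp_pt_left_appTop (φ : H →ₐ[R] Alg T) :
    (Scheme.ΓSpecIso (CommRingCat.of H)).inv ≫ (pt φ).left.appTop = homΓ φ := by
  change (Scheme.ΓSpecIso (CommRingCat.of H)).inv ≫ (Spec.map (homΓ φ)).appTop ≫ T.left.toSpecΓ.appTop = homΓ φ
  rw [Scheme.toSpecΓ_appTop, ← Category.assoc, ← Scheme.ΓSpecIso_inv_naturality, Category.assoc, Iso.inv_hom_id,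
    Category.comp_id]

/-- **`coord ∘ pt = id`.** [cite: GortzWedhorn2023, §(27.2) (p. 606)] -/
theorem coord_pt (φ : H →ₐ[R] Alg T) : coord (pt φ) = φ :=
  homΓ_injective (by rw [homΓ_coord, ΓSpecIso_inv_comp_pt_left_appTop])

/-- **`pt ∘ coord = id`** (a morphism to `Spec H` is determined by its map on global sections, Mathlib `ext_to_Spec`).
[cite: GortzWedhorn2023, §(27.2) (p. 606)] -/
theorem pt_coord (x : T ⟶ specOver R H) : pt (coord x) = x := by
  ext1
  apply ext_to_Spec
  change (Scheme.ΓSpecIso (CommRingCat.of H)).inv ≫ (pt (coord x)).left.appTop =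
    (Scheme.ΓSpecIso (CommRingCat.of H)).inv ≫ x.left.appTop
  rw [ΓSpecIso_inv_comp_pt_left_appTop, homΓ_coord]

variable (H T) in
/-- **`Hom_R(T, Spec H) ≃ Hom_{R-alg}(H, Γ(T, 𝒪_T))`** for every `R`-scheme `T` ([GortzWedhorn2023] §(27.2); Mathlib's `ΓSpec` adjunction
in `R`-algebra clothing). [cite: GortzWedhorn2023, §(27.2) (p. 606)] -/
def coordEquiv : (T ⟶ specOver R H) ≃ (H →ₐ[R] Alg T) where
  toFun := coord
  invFun := pt
  left_inv := pt_coord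
  right_inv := coord_pt

/-- `coordEquiv` is `coord`. [cite: GortzWedhorn2023, §(27.2) (p. 606)] -/
theorem coordEquiv_apply (x : T ⟶ specOver R H) : coordEquiv H T x = coord x := rfl

/-- **A `T`-point of `Spec H` is determined by its coordinates.** [cite: GortzWedhorn2023, §(27.2) (p. 606)] -/
theorem coord_injective : Function.Injective (coord : (T ⟶ specOver R H) → (H →ₐ[R] Alg T)) :=
  (coordEquiv H T).injective

end Coord

/-! ## §2 The group object of a functorial group law -/

section Law

variable {H : Type u} [CommRing H] [Algebra R H] (L : CorepGroupLaw R H) {T : SchemeOver R}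

/-- The multiplication `Spec H × Spec H → Spec H`: the point whose coordinates are the product of the two projections.
[cite: GortzWedhorn2023, §(27.2) (27.2.1) (p. 606)] -/
def mulOfLaw : specOver R H ⊗ specOver R H ⟶ specOver R H :=
  pt (L.mul (coord (fst (specOver R H) (specOver R H))) (coord (snd (specOver R H) (specOver R H))))

/-- The unit `Spec R → Spec H`: the point whose coordinates are the unit point. [cite: GortzWedhorn2023, §(27.2) (27.2.1) (p. 606)] -/
def oneOfLaw : 𝟙_ (SchemeOver R) ⟶ specOver R H :=
  pt (L.one (Alg (𝟙_ (SchemeOver R))))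

/-- The inversion `Spec H → Spec H`: the point whose coordinates are the inverse of the universal point.
[cite: GortzWedhorn2023, §(27.2) (27.2.1) (p. 606)] -/
def invOfLaw : specOver R H ⟶ specOver R H :=
  pt (L.inv (coord (𝟙 (specOver R H))))

/-- **Coordinates of a product of points**: `coord (⟨a, b⟩ ≫ m) = a · b`. [cite: GortzWedhorn2023, §(27.2) (p. 606)] -/
theorem coord_lift_comp_mulOfLaw (a b : T ⟶ specOver R H) : coord (lift a b ≫ mulOfLaw L) = L.mul (coord a) (coord b) := by
  rw [coord_comp, mulOfLaw, coord_pt, L.comp_mul, ← coord_comp, ← coord_comp, lift_fst, lift_snd]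

/-- **Coordinates of the unit point of `T`.** [cite: GortzWedhorn2023, §(27.2) (p. 606)] -/
theorem coord_toUnit_comp_oneOfLaw : coord (toUnit T ≫ oneOfLaw L) = L.one (Alg T) := by
  rw [coord_comp, oneOfLaw, coord_pt, L.comp_one]

/-- **Coordinates of the inverse of a point.** [cite: GortzWedhorn2023, §(27.2) (p. 606)] -/
theorem coord_comp_invOfLaw (a : T ⟶ specOver R H) : coord (a ≫ invOfLaw L) = L.inv (coord a) := by
  rw [coord_comp, invOfLaw, coord_pt, L.comp_inv, ← coord_comp, Category.comp_id]

/-- **The pointwise group axioms hold**, hence a group object with structure morphisms `mulOfLaw ∕ oneOfLaw ∕ invOfLaw`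
(★ `exists_grpObj_of_pointwise`; [SGA3] I 2.3.3). [cite: GortzWedhorn2023, §(27.2) Def. 27.6 (p. 606)] -/
theorem exists_grpObj_of_law : ∃ G : GrpObj (specOver R H),
    @MonObj.mul _ _ _ (specOver R H) G.toMonObj = mulOfLaw L ∧ @MonObj.one _ _ _ (specOver R H) G.toMonObj = oneOfLaw L ∧
      @GrpObj.inv _ _ _ (specOver R H) G = invOfLaw L := by
  refine exists_grpObj_of_pointwise (mulOfLaw L) (oneOfLaw L) (invOfLaw L) ?_ ?_ ?_ ?_
  · intro T a b c
    apply coord_injective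
    rw [coord_lift_comp_mulOfLaw, coord_lift_comp_mulOfLaw, coord_lift_comp_mulOfLaw, coord_lift_comp_mulOfLaw, L.mul_assoc]
  · intro T a
    apply coord_injective
    rw [coord_lift_comp_mulOfLaw, coord_toUnit_comp_oneOfLaw, L.one_mul]
  · intro T a
    apply coord_injective
    rw [coord_lift_comp_mulOfLaw, coord_toUnit_comp_oneOfLaw, L.mul_one]
  · intro T a
    apply coord_injective
    rw [coord_lift_comp_mulOfLaw, coord_comp_invOfLaw, L.inv_mul, coord_toUnit_comp_oneOfLaw]

/-- **The affine group scheme `Spec H → Spec R` of the functorial group law `L`** ([GortzWedhorn2023] Def. 27.6: a group-valued structure on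
the functor of points IS a group scheme structure). [cite: GortzWedhorn2023, §(27.2) Def. 27.6 (p. 606)] -/
@[reducible] def grpObjOfLaw : GrpObj (specOver R H) := (exists_grpObj_of_law L).choose

/-- Its multiplication is `mulOfLaw L`. [cite: GortzWedhorn2023, §(27.2) (27.2.1) (p. 606)] -/
theorem grpObjOfLaw_mul : @MonObj.mul _ _ _ (specOver R H) (grpObjOfLaw L).toMonObj = mulOfLaw L :=
  (exists_grpObj_of_law L).choose_spec.1

/-- Its unit is `oneOfLaw L`. [cite: GortzWedhorn2023, §(27.2) (27.2.1) (p. 606)] -/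
theorem grpObjOfLaw_one : @MonObj.one _ _ _ (specOver R H) (grpObjOfLaw L).toMonObj = oneOfLaw L :=
  (exists_grpObj_of_law L).choose_spec.2.1

/-- Its inversion is `invOfLaw L`. [cite: GortzWedhorn2023, §(27.2) (27.2.1) (p. 606)] -/
theorem grpObjOfLaw_inv : @GrpObj.inv _ _ _ (specOver R H) (grpObjOfLaw L) = invOfLaw L :=
  (exists_grpObj_of_law L).choose_spec.2.2

/-- **On `T`-points the group object IS the law**: `coord (a * b) = a · b` (Mathlib's scoped `Hom.group`).
[cite: GortzWedhorn2023, §(27.2) Def. 27.6 (p. 606)] -/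
theorem coord_mul (a b : T ⟶ specOver R H) :
    letI := grpObjOfLaw L; coord (a * b) = L.mul (coord a) (coord b) := by
  letI := grpObjOfLaw L
  rw [Hom.mul_def, grpObjOfLaw_mul, coord_lift_comp_mulOfLaw]

/-- `coord 1 = L.one`. [cite: GortzWedhorn2023, §(27.2) Def. 27.6 (p. 606)] -/
theorem coord_one : letI := grpObjOfLaw L; coord (1 : T ⟶ specOver R H) = L.one (Alg T) := by
  letI := grpObjOfLaw L
  rw [Hom.one_def, grpObjOfLaw_one, coord_toUnit_comp_oneOfLaw]

/-- `coord a⁻¹ = L.inv (coord a)`. [cite: GortzWedhorn2023, §(27.2) Def. 27.6 (p. 606)] -/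
theorem coord_inv (a : T ⟶ specOver R H) : letI := grpObjOfLaw L; coord a⁻¹ = L.inv (coord a) := by
  letI := grpObjOfLaw L
  rw [Hom.inv_def, grpObjOfLaw_inv, coord_comp_invOfLaw]

/-- **A commutative law gives a commutative group scheme.** [cite: GortzWedhorn2023, §(27.2) (p. 607)] -/
theorem isCommMonObj_grpObjOfLaw
    (hcomm : ∀ {R' : Type u} [CommRing R'] [Algebra R R'] (x y : H →ₐ[R] R'), L.mul x y = L.mul y x) :
    letI := grpObjOfLaw L; IsCommMonObj (specOver R H) := by
  letI := grpObjOfLaw L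
  refine ⟨?_⟩
  rw [← lift_snd_fst, grpObjOfLaw_mul]
  apply coord_injective
  rw [coord_lift_comp_mulOfLaw, hcomm, ← coord_lift_comp_mulOfLaw L, lift_fst_snd, Category.id_comp]

end Law

/-! ## §3 The functorial group law of a commutative Hopf algebra (convolution of points) -/

section Hopf

variable (R) (H : Type u) [CommRing H] [HopfAlgebra R H] {R' : Type u} [CommRing R'] [Algebra R R']

/-- **The antipode inverts points** valued in ANY commutative `R`-algebra `R′`: `(x ∘ S) * x = 1` in the convolution monoid
`WithConv (H →ₐ[R] R′)` (Mathlib's `AlgHom.convGroup` is stated with a bialgebra target; the proof only uses `S * id = 1` on `H`,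
Mathlib `AlgHom.antipode_id_cancel`, transported along `x`). [cite: GortzWedhorn2023, §(27.2) (27.2.1) (p. 606)] -/
theorem toConv_comp_antipodeAlgHom_mul (x : H →ₐ[R] R') :
    toConv (x.comp (HopfAlgebra.antipodeAlgHom R H)) * toConv x = 1 := by
  have h := AlgHom.comp_convMul_distrib x (toConv (HopfAlgebra.antipodeAlgHom R H)) (toConv (AlgHom.id R H))
  rw [AlgHom.antipode_id_cancel, ofConv_toConv, ofConv_toConv, AlgHom.comp_id] at h
  rw [← toConv_ofConv (toConv (x.comp (HopfAlgebra.antipodeAlgHom R H)) * toConv x), ← h, AlgHom.convOne_def, AlgHom.convOne_def,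
    ofConv_toConv]
  congr 1
  ext a
  simp

/-- **The functorial group law of the commutative Hopf algebra `H`**: on `Hom_{R-alg}(H, R′)` the product is convolution
`(x · y) = μ_{R′} ∘ (x ⊗ y) ∘ Δ`, the unit is `η_{R′} ∘ ε`, the inverse is `x ∘ S` ([GortzWedhorn2023] (27.2.1)).
[cite: GortzWedhorn2023, §(27.2) (27.2.1) (p. 606)] -/
def lawOfHopfAlgebra : CorepGroupLaw R H where
  mul := fun ⦃R'⦄ _ _ x y => (toConv x * toConv y).ofConv
  one := fun R' _ _ => (1 : WithConv (H →ₐ[R] R')).ofConv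
  inv := fun ⦃R'⦄ _ _ x => x.comp (HopfAlgebra.antipodeAlgHom R H)
  mul_assoc := fun x y z => by
    change ((toConv x * toConv y) * toConv z).ofConv = (toConv x * (toConv y * toConv z)).ofConv
    rw [mul_assoc]
  one_mul := fun x => by
    change ((1 : WithConv (H →ₐ[R] _)) * toConv x).ofConv = x
    rw [one_mul, ofConv_toConv]
  inv_mul := fun x => by
    rw [toConv_comp_antipodeAlgHom_mul]
  comp_mul := fun φ x y => by
    rw [AlgHom.comp_convMul_distrib, ofConv_toConv, ofConv_toConv]
  comp_one := fun φ => by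
    rw [AlgHom.convOne_def, AlgHom.convOne_def, ofConv_toConv, ofConv_toConv]
    ext a
    simp

/-- The product of the law is convolution. [cite: GortzWedhorn2023, §(27.2) (27.2.1) (p. 606)] -/
theorem lawOfHopfAlgebra_mul (x y : H →ₐ[R] R') : (lawOfHopfAlgebra R H).mul x y = (toConv x * toConv y).ofConv := rfl

/-- The unit of the law is the convolution unit `η ∘ ε`. [cite: GortzWedhorn2023, §(27.2) (27.2.1) (p. 606)] -/
theorem lawOfHopfAlgebra_one : (lawOfHopfAlgebra R H).one R' = (1 : WithConv (H →ₐ[R] R')).ofConv := rfl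

/-- The inverse of the law is precomposition with the antipode. [cite: GortzWedhorn2023, §(27.2) (27.2.1) (p. 606)] -/
theorem lawOfHopfAlgebra_inv (x : H →ₐ[R] R') : (lawOfHopfAlgebra R H).inv x = x.comp (HopfAlgebra.antipodeAlgHom R H) := rfl

/-- **The comultiplication of the law is `Δ`** (the product of the two coprojections `H → H ⊗ H` is the identity of `H ⊗ H` after `Δ`).
[cite: GortzWedhorn2023, §(27.2) (27.2.1) (p. 606)] -/
theorem lawOfHopfAlgebra_comul : (lawOfHopfAlgebra R H).comul = Bialgebra.comulAlgHom R H := by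
  rw [CorepGroupLaw.comul_def, lawOfHopfAlgebra_mul, AlgHom.convMul_def, ofConv_toConv, ofConv_toConv, ofConv_toConv,
    ← AlgHom.comp_assoc]
  have h : (Algebra.TensorProduct.lmul' R).comp
      (Algebra.TensorProduct.map (Algebra.TensorProduct.includeLeft : H →ₐ[R] H ⊗[R] H) Algebra.TensorProduct.includeRight) =
      AlgHom.id R (H ⊗[R] H) := by
    apply Algebra.TensorProduct.ext'
    intro a b
    simp
  rw [h, AlgHom.id_comp]

/-- **The counit of the law is `ε`.** [cite: GortzWedhorn2023, §(27.2) (27.2.1) (p. 606)] -/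
theorem lawOfHopfAlgebra_counit : (lawOfHopfAlgebra R H).counit = Bialgebra.counitAlgHom R H := by
  change (1 : WithConv (H →ₐ[R] R)).ofConv = _
  rw [AlgHom.convOne_def, ofConv_toConv]
  ext a
  simp

/-- **The antipode of the law is `S`.** [cite: GortzWedhorn2023, §(27.2) (27.2.1) (p. 606)] -/
theorem lawOfHopfAlgebra_antipodeAlgHom : (lawOfHopfAlgebra R H).antipodeAlgHom = HopfAlgebra.antipodeAlgHom R H :=
  AlgHom.id_comp _

end Hopf

/-! ## §4 The affine group scheme `Spec H → Spec R` of a commutative Hopf algebra -/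

section HopfScheme

variable (R) (H : Type u) [CommRing H] [HopfAlgebra R H] {T : SchemeOver R}

/-- **The affine group scheme of the commutative Hopf `R`-algebra `H`**: the group object structure on `specOver R H = (Spec H → Spec R)`
whose `T`-points multiply by convolution ([GortzWedhorn2023] §(27.2), Def. 27.6). [cite: GortzWedhorn2023, §(27.2) Def. 27.6 (p. 606)] -/
@[reducible] def grpObjOfHopfAlgebra : GrpObj (specOver R H) := grpObjOfLaw (lawOfHopfAlgebra R H)

variable (T) in
/-- **`(Spec H)(T) ≃* WithConv (H →ₐ[R] Γ(T, 𝒪_T))`**: the group of `T`-points is the convolution group of `Γ(T)`-valued points of `H`.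
[cite: GortzWedhorn2023, §(27.2) Def. 27.6 (p. 606)] -/
def coordMulEquiv : letI := grpObjOfHopfAlgebra R H; (T ⟶ specOver R H) ≃* WithConv (H →ₐ[R] Alg T) :=
  letI := grpObjOfHopfAlgebra R H
  { toFun := fun a => toConv (coord a)
    invFun := fun f => pt f.ofConv
    left_inv := fun a => pt_coord a
    right_inv := fun f => by
      change toConv (coord (pt f.ofConv)) = f
      rw [coord_pt, toConv_ofConv]
    map_mul' := fun a b => by
      change toConv (coord (a * b)) = toConv (coord a) * toConv (coord b)
      rw [coord_mul (lawOfHopfAlgebra R H), lawOfHopfAlgebra_mul, toConv_ofConv] }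

/-- `coordMulEquiv` is `coord`. [cite: GortzWedhorn2023, §(27.2) Def. 27.6 (p. 606)] -/
theorem coordMulEquiv_apply (a : T ⟶ specOver R H) :
    letI := grpObjOfHopfAlgebra R H; coordMulEquiv R H T a = toConv (coord a) := rfl

/-- **Product of points = convolution of coordinates.** [cite: GortzWedhorn2023, §(27.2) Def. 27.6 (p. 606)] -/
theorem coord_mul_eq (a b : T ⟶ specOver R H) :
    letI := grpObjOfHopfAlgebra R H; coord (a * b) = (toConv (coord a) * toConv (coord b)).ofConv :=
  coord_mul (lawOfHopfAlgebra R H) a b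

/-- **Unit point = convolution unit.** [cite: GortzWedhorn2023, §(27.2) Def. 27.6 (p. 606)] -/
theorem coord_one_eq : letI := grpObjOfHopfAlgebra R H; coord (1 : T ⟶ specOver R H) = (1 : WithConv (H →ₐ[R] Alg T)).ofConv :=
  coord_one (lawOfHopfAlgebra R H)

/-- **Inverse point = coordinates precomposed with the antipode.** [cite: GortzWedhorn2023, §(27.2) Def. 27.6 (p. 606)] -/
theorem coord_inv_eq (a : T ⟶ specOver R H) :
    letI := grpObjOfHopfAlgebra R H; coord a⁻¹ = (coord a).comp (HopfAlgebra.antipodeAlgHom R H) :=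
  coord_inv (lawOfHopfAlgebra R H) a

/-- **Cocommutative Hopf algebra ⇒ commutative group scheme** ([GortzWedhorn2023] §(27.2), printed p. 607).
[cite: GortzWedhorn2023, §(27.2) (p. 607)] -/
theorem isCommMonObj_grpObjOfHopfAlgebra [Coalgebra.IsCocomm R H] :
    letI := grpObjOfHopfAlgebra R H; IsCommMonObj (specOver R H) :=
  isCommMonObj_grpObjOfLaw (lawOfHopfAlgebra R H) fun x y => by
    rw [lawOfHopfAlgebra_mul, lawOfHopfAlgebra_mul, mul_comm]

end HopfScheme

end AffineGroupScheme

end Literature.AlgebraicGeometry.GroupSchemes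

end
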